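import Mathlib.Probability.Moments.SubGaussian
import Summits.QuantumFields.YangMills.Theorems.U1TorusFluxGaussianDominationReal
import HarnessLib

/-!
# Gross's Gaussian domination in Mathlib's currency: the `U(1)` torus flux of an exact cochain `HasSubgaussianMGF`
# (LINE 28 «gross-sd-transfer» abelian sibling; crux `HistoryTailL`, stmt-QuantumFields-19936)

Cell `ym3-torus` (YM ladder rung R3 = continuum SU(2) Yang–Mills on T³ — a RUNG, NOT the Clay problem); WIDTH helper seat `ym3-torus-px8` g9.
Helper `--supports stmt-QuantumFields-19936`; THEOREMS ONLY (0 `def`, 0 `sorry`, default heartbeats).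

WHAT.  ✓`U1TorusFluxGaussianDomination.integral_exp_mul_flux_le` (integer cochains) and ✓`U1TorusFluxGaussianDominationReal.integral_exp_mul_realFlux_le`
(real cochains) — Gross CMP 92 Thm 2.2 for Wilson `U(1)` on the torus — say, token for token, that the flux of an exact 2-cochain is
SUB-GAUSSIAN with variance proxy `‖dc‖²∕β` under the Wilson state in the sense of Mathlib's `ProbabilityTheory.HasSubgaussianMGF`
(`mgf X μ t ≤ exp(c t²∕2)` for all `t`, plus integrability).  This file states exactly that (★★ `hasSubgaussianMGF_flux`,
★★ `hasSubgaussianMGF_realFlux`), so every consumer gets Mathlib's sub-Gaussian API (`HasSubgaussianMGF.measure_ge_le` Chernoff tails,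
`.neg`, `.add`, `.cgf_le`, `.memLp`, …) by name; as a check, Mathlib's Chernoff bound reproduces the tail
(`measureReal_flux_ge_le_mathlib`).
HONEST SCOPE.  Packaging of landed abelian theorems; nothing about SU(2) ∕ S_dom ∕ «ShallowFluxSecondMomentL» ∕ (Q) ∕ K1 ∕ `MeanDeviationL` ∕
`HistoryTailL` ∕ any crux or rung statement is proved or claimed; YM₃ on T³ is rung R3, not Clay; YM gap NOT proved.

Reference: L. Gross, CMP 92 (1983) 137–162, Thm 2.2 [GrossCMP1983]; Boucheron–Lugosi–Massart, Concentration Inequalities (2013) §2.3 [BoucheronLugosiMassart2013].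
-/

set_option autoImplicit false

noncomputable section

open scoped BigOperators NNReal
open MeasureTheory ProbabilityTheory
open Literature.MathematicalPhysics.QuantumFieldTheory Literature.MathematicalPhysics.QuantumLattice
open Summit.QuantumFields.YangMills.Theorems.U1TorusFluxGaussianDomination
open Summit.QuantumFields.YangMills.Theorems.U1TorusFluxGaussianDominationReal

namespace Summit.QuantumFields.YangMills.Theorems.U1TorusFluxSubgaussianMGF

variable {d L : ℕ} [NeZero L]

/-- ★★ **THE INTEGER-COCHAIN FLUX IS SUB-GAUSSIAN (Mathlib `HasSubgaussianMGF`) WITH PROXY `‖dc‖²∕β`.** For `β > 0` and every integer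
1-cochain `c` on the torus, `F(dc) = actionFlowDeriv c` satisfies `HasSubgaussianMGF (actionFlowDeriv c) (‖dc‖²∕β).toNNReal (wilsonMeasure u1Rep β)`.
[cite: GrossCMP1983, Thm 2.2] -/
theorem hasSubgaussianMGF_flux (c : Edge d L → ℤ) {β : ℝ} (hβ : 0 < β) :
    HasSubgaussianMGF (actionFlowDeriv c)
      (Real.toNNReal ((∑ p : Plaquette d L, (plaqCharge c p.1 p.2.1.1 p.2.1.2 : ℝ) ^ 2) / β))
      (wilsonMeasure (d := d) (L := L) u1Rep β) := by
  haveI := isProbabilityMeasure_wilsonMeasure (d := d) (L := L) u1Rep continuous_u1Rep β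
  have hN : 0 ≤ (∑ p : Plaquette d L, (plaqCharge c p.1 p.2.1.1 p.2.1.2 : ℝ) ^ 2) / β :=
    div_nonneg (Finset.sum_nonneg fun _ _ => sq_nonneg _) hβ.le
  refine ⟨fun t => ?_, fun t => ?_⟩
  · exact (Real.continuous_exp.comp (continuous_const.mul (continuous_actionFlowDeriv c))).integrable_of_hasCompactSupport
      (HasCompactSupport.of_compactSpace _)
  · simp only [mgf, Real.coe_toNNReal _ hN]
    refine (integral_exp_mul_flux_le (d := d) (L := L) c hβ t).trans_eq ?_
    congr 1; ring

/-- ★★ **THE REAL-COCHAIN FLUX IS SUB-GAUSSIAN WITH PROXY `‖du‖²∕β`** (Gross Thm 2.2 in print's generality on the torus, Mathlib currency).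
[cite: GrossCMP1983, Thm 2.2] -/
theorem hasSubgaussianMGF_realFlux (u : Edge d L → ℝ) {β : ℝ} (hβ : 0 < β) :
    HasSubgaussianMGF (fun U : GaugeConfig d L Circle => ∑ p : Plaquette d L,
        (u (p.1, p.2.1.1) + u (p.1.shift p.2.1.1, p.2.1.2) - u (p.1.shift p.2.1.2, p.2.1.1) - u (p.1, p.2.1.2)) *
          ((plaquetteHolonomy U p.1 p.2.1.1 p.2.1.2 : Circle) : ℂ).im)
      (Real.toNNReal ((∑ p : Plaquette d L, (u (p.1, p.2.1.1) + u (p.1.shift p.2.1.1, p.2.1.2) - u (p.1.shift p.2.1.2, p.2.1.1) -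
          u (p.1, p.2.1.2)) ^ 2) / β))
      (wilsonMeasure (d := d) (L := L) u1Rep β) := by
  haveI := isProbabilityMeasure_wilsonMeasure (d := d) (L := L) u1Rep continuous_u1Rep β
  have hN : 0 ≤ (∑ p : Plaquette d L, (u (p.1, p.2.1.1) + u (p.1.shift p.2.1.1, p.2.1.2) - u (p.1.shift p.2.1.2, p.2.1.1) -
      u (p.1, p.2.1.2)) ^ 2) / β := div_nonneg (Finset.sum_nonneg fun _ _ => sq_nonneg _) hβ.le
  refine ⟨fun t => ?_, fun t => ?_⟩
  · exact (Real.continuous_exp.comp (continuous_const.mul (continuous_realFlux u))).integrable_of_hasCompactSupport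
      (HasCompactSupport.of_compactSpace _)
  · simp only [mgf, Real.coe_toNNReal _ hN]
    refine (integral_exp_mul_realFlux_le (d := d) (L := L) u hβ t).trans_eq ?_
    congr 1; ring

/-- The flux of `−c` is minus the flux of `c`, so sub-Gaussianity is symmetric (Mathlib `HasSubgaussianMGF.neg`). [folklore] -/
theorem hasSubgaussianMGF_neg_flux (c : Edge d L → ℤ) {β : ℝ} (hβ : 0 < β) :
    HasSubgaussianMGF (fun U => -actionFlowDeriv c U)
      (Real.toNNReal ((∑ p : Plaquette d L, (plaqCharge c p.1 p.2.1.1 p.2.1.2 : ℝ) ^ 2) / β))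
      (wilsonMeasure (d := d) (L := L) u1Rep β) :=
  (hasSubgaussianMGF_flux c hβ).neg

/-- ★ Consistency check through Mathlib's Chernoff bound: `μ_β{θ ≤ F(dc)} ≤ exp(−θ²∕(2‖dc‖²∕β))` for `θ ≥ 0` — the tail of
✓`measureReal_flux_ge_le_opt`, now by `HasSubgaussianMGF.measure_ge_le`. [cite: BoucheronLugosiMassart2013, §2.3] -/
theorem measureReal_flux_ge_le_mathlib (c : Edge d L → ℤ) {β : ℝ} (hβ : 0 < β) {θ : ℝ} (hθ : 0 ≤ θ) :
    (wilsonMeasure (d := d) (L := L) u1Rep β).real {U | θ ≤ actionFlowDeriv c U} ≤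
      Real.exp (-θ ^ 2 / (2 * ((∑ p : Plaquette d L, (plaqCharge c p.1 p.2.1.1 p.2.1.2 : ℝ) ^ 2) / β))) := by
  have hN : 0 ≤ (∑ p : Plaquette d L, (plaqCharge c p.1 p.2.1.1 p.2.1.2 : ℝ) ^ 2) / β :=
    div_nonneg (Finset.sum_nonneg fun _ _ => sq_nonneg _) hβ.le
  have h := (hasSubgaussianMGF_flux (d := d) (L := L) c hβ).measure_ge_le hθ
  rw [Real.coe_toNNReal _ hN] at h
  exact h

end Summit.QuantumFields.YangMills.Theorems.U1TorusFluxSubgaussianMGF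

end
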